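import Summits.QuantumFields.YangMills.Theorems.BalabanUVNodesPortS1G3CNeumannRec
import Summits.QuantumFields.YangMills.Theorems.BalabanUVNodesPortS1G3COpen
import Literature.Analysis.Matrix.CramerRuleHolomorphic
import Literature.Analysis.Complex.LocallyUniformLimitSCV

/-!
# NODE O port PT-A — `stub_G3C` (repaired edition `G3CAtRecordL`), layer (γ): HOLOMORPHY, THE x-UNIFORM BOUND AND x-CONTINUITY OF THE WALK PIECES `W(X)` on a set of pairs where
# the point predicate holds with analytic entries (the open `O_X` of ✓`exists_open_g3cPt`) — rows (g2)(g3)(g5) of `G3CPiecesAt` for `W`, by the finite-dimensional SCV M-test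

Cell `ym-nodeO-ideate`, porter hand `hand-27930-G3C` (g1); `--supports stmt-QuantumFields-27930`; count-neutral.  [16] = [Balaban1985UV3], [B9] = [Balaban1985BackgroundPropagators],
[I] = [Balaban1987RG1].

WHY (memo §5c rows (g2)(g3)(g5); [I] (1.18) p.263, [16] p.272 «G̃₃(x) has the same properties as G̃₂»).  On `O_X` every entry of every `T_Y`, `Y ⊆ X`, is analytic and every block `T^{(Z)}|_Z`,
`Z ⊆ X`, is coercive with `γ₀/2`, so the local inverses `G_Z(x, ·)` have holomorphic entries (Cramer, ✓`Literature.Analysis.Matrix.differentiableOn_matrix_inv`), hence so do the step matrices,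
the walk terms (finite products and a trace) and `W_m(X)(x, ·)`; with the x-UNIFORM majorant `|W_m(X)| ≤ B₀(X)·2^{−m}` (✓`norm_g3cWm_le`, ✓`sum_g3cStepWt_le`, `Λ ≤ ½`) the series
`W(X) = Σ(−1)ᵐW_m(X)` is holomorphic on `O_X` (✓`Literature.Analysis.Complex.SCV.analyticOnNhd_tsum_of_summable_norm`), bounded by `2B₀(X)`, and continuous in `x ∈ [0, ∞)` at each pair
(✓`continuousOn_tsum`, entries of `G_Z(·, φ)` continuous by ✓`continuousOn_g3cLocInv_apply_of_coer`).

WHAT THIS FILE PROVES (sorry-free): entrywise bookkeeping `differentiableOn_ofFn_prod_apply` ∕ `continuousOn_ofFn_prod_apply`; `differentiableOn_g3cLocInv_apply`, `differentiableOn_g3cStepM_apply`,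
`differentiableOn_g3cWalkTerm`, `differentiableOn_g3cWm`; `continuousOn_g3cStepM_apply`, `continuousOn_g3cWalkTerm`, `continuousOn_g3cWm`; ★`norm_g3cW_le` (`|W(X)| ≤ 2B₀(X)`),
★`differentiableOn_g3cW`, ★`continuousOn_g3cW`.

HONEST FRAMING.  Finite-dimensional holomorphy bookkeeping under point hypotheses (asserted for nothing); nothing of Bałaban asserted, ported or discharged; `stub_G3C` NOT closed; 27930
OPEN; NODE O 0∕1; COUNT 8∕28 · K 1∕4 UNMOVED; finite `𝕋⁴_{L^K}` at fixed ε — NOT continuum ∕ OS ∕ Clay; **the Yang–Mills mass gap is NOT proved by any of this.**  No `sorry`, no `instance`,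
no `notation`; standard axioms.
-/

noncomputable section

open scoped BigOperators Matrix.Norms.L2Operator Topology Matrix Classical
open Filter Finset

namespace Summit.QuantumFields.YangMills.Theorems.BalabanUVNodesPortS1

open Summit.QuantumFields.YangMills.Theorems.K0RecordFormatNames
open Literature.MathematicalPhysics.QuantumFieldTheory.Balaban1983to89
open Literature.MathematicalPhysics.QuantumFieldTheory.Balaban1983to89.Node00
open Literature.MathematicalPhysics.QuantumFieldTheory.Balaban1983to89.T4Continuum (T4Family)
open Literature.MathematicalPhysics.QuantumFieldTheory.Balaban1983to89.TreeLengthTorus (TPt IsTDom TFaceConnected torusTreeLen torusTreeLen_nonneg)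
open Literature.MathematicalPhysics.QuantumFieldTheory.Balaban1983to89.B12TreeDecay (K₀ kappa₀ K₀_pos kappa₀_nonneg)
open Literature.MathematicalPhysics.QuantumFieldTheory.Balaban1983to89.B5Prop11Lower (nsq nsq_nonneg)
open Literature.Analysis.Matrix (differentiableOn_matrix_inv differentiableOn_matrix_mul continuousOn_matrix_mul)

/-! ## §0  Entrywise bookkeeping for ordered products -/

section Generic

variable {E : Type*} [NormedAddCommGroup E] [NormedSpace ℂ E] {ι : Type*} [Fintype ι] [DecidableEq ι]

/-- Entries of an ordered product of matrices of holomorphic functions are holomorphic. [folklore] -/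
theorem differentiableOn_ofFn_prod_apply {s : Set E} : ∀ {m : ℕ} (S : Fin m → E → Matrix ι ι ℂ),
    (∀ i a b, DifferentiableOn ℂ (fun y => S i y a b) s) → ∀ a b, DifferentiableOn ℂ (fun y => (List.ofFn fun i => S i y).prod a b) s := by
  intro m
  induction m with
  | zero =>
      intro S _ a b
      simp only [List.ofFn_zero, List.prod_nil]
      exact differentiableOn_const _
  | succ m ih =>
      intro S hS a b
      simp only [List.ofFn_succ, List.prod_cons]
      exact differentiableOn_matrix_mul (hS 0) (ih (fun i => S i.succ) fun i => hS i.succ) a b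

/-- Entries of an ordered product of matrices of continuous functions are continuous. [folklore] -/
theorem continuousOn_ofFn_prod_apply {T : Type*} [TopologicalSpace T] {s : Set T} : ∀ {m : ℕ} (S : Fin m → T → Matrix ι ι ℂ),
    (∀ i a b, ContinuousOn (fun y => S i y a b) s) → ∀ a b, ContinuousOn (fun y => (List.ofFn fun i => S i y).prod a b) s := by
  intro m
  induction m with
  | zero =>
      intro S _ a b
      simp only [List.ofFn_zero, List.prod_nil]
      exact continuousOn_const
  | succ m ih =>
      intro S hS a b
      simp only [List.ofFn_succ, List.prod_cons]
      exact continuousOn_matrix_mul (hS 0) (ih (fun i => S i.succ) fun i => hS i.succ) a b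

end Generic

section Holo

variable {F : T4Family}
variable {a₀ δ₀ c₀ γ₀ γ₁ δ₁ : ℝ} {Mc : ℕ} {α₀ α₁ ε₂₉ : ℝ} {k : ℕ}
variable {TC : (n : ℕ) → Sect2.CPair (F.P (recordK₀ F Mc k + n)) (MatA 2) → FluctIdx F k (recordK₀ F Mc k + n) → FluctIdx F k (recordK₀ F Mc k + n) → ℂ}
variable {TY : (n : ℕ) → (recordDomSys F Mc k (recordK₀ F Mc k + n)).Dom → Sect2.CPair (F.P (recordK₀ F Mc k + n)) (MatA 2) →
  FluctIdx F k (recordK₀ F Mc k + n) → FluctIdx F k (recordK₀ F Mc k + n) → ℂ}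
variable {TZY : Finset (Fin 4 → ℤ) → IntBondCfg → ((Fin 4 → ℤ) × Fin 4) × Fin 3 → ((Fin 4 → ℤ) × Fin 4) × Fin 3 → ℂ}
variable {AdM : (n : ℕ) → (Site (F.P (recordK₀ F Mc k + n)) 0 → (MatA 2)ˣ) →
  Matrix (FluctIdx F k (recordK₀ F Mc k + n)) (FluctIdx F k (recordK₀ F Mc k + n)) ℂ}
variable {AdZ : ((Fin 4 → ℤ) → (MatA 2)ˣ) → (Fin 4 → ℤ) × Fin 4 → Matrix (Fin 3) (Fin 3) ℂ}

/-! ## §1  Holomorphy in the pair on a set of good pairs -/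

/-- **Entries of `G_Z(x, ·)` are holomorphic** on a set of pairs where the pieces `T_Y`, `Y ⊆ Z`, have analytic entries and `T^{(Z)}|_Z` is coercive with `γ > 0` (Cramer; the determinant is a unit).
[cite: Balaban1987RG1, (1.18) p.263; Balaban1985UV3, p.272 (after (63))] -/
theorem differentiableOn_g3cLocInv_apply {γ : ℝ} (hγ : 0 < γ) (n : ℕ) (Z : (recordDomSys F Mc k (recordK₀ F Mc k + n)).Dom)
    {O : Set (Sect2.CPair (F.P (recordK₀ F Mc k + n)) (MatA 2))}
    (han : ∀ φ ∈ O, ∀ Y : (recordDomSys F Mc k (recordK₀ F Mc k + n)).Dom, Y.1 ⊆ Z.1 →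
      ∀ i j : FluctIdx F k (recordK₀ F Mc k + n), AnalyticAt ℂ (fun ψ : Sect2.CPair (F.P (recordK₀ F Mc k + n)) (MatA 2) => TY n Y ψ i j) φ)
    (hco : ∀ φ ∈ O, ∀ z : {i : NonB0Idx F k (recordK₀ F Mc k + n) // g3cInDom F Mc k (recordK₀ F Mc k + n) Z i} → ℂ,
      γ * nsq z ≤ (star z ⬝ᵥ ((g3cLocOp F Mc k (recordK₀ F Mc k + n) (TY n) Z φ).submatrix
        (Subtype.val : {i : NonB0Idx F k (recordK₀ F Mc k + n) // g3cInDom F Mc k (recordK₀ F Mc k + n) Z i} → _) Subtype.val *ᵥ z)).re)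
    {x : ℝ} (hx : 0 ≤ x) (a b : NonB0Idx F k (recordK₀ F Mc k + n)) :
    DifferentiableOn ℂ (fun φ => g3cLocInv F Mc k (recordK₀ F Mc k + n) (TY n) Z x φ a b) O := by
  by_cases ha : g3cInDom F Mc k (recordK₀ F Mc k + n) Z a
  · by_cases hb : g3cInDom F Mc k (recordK₀ F Mc k + n) Z b
    · simp only [g3cLocInv_apply_of_mem Mc k _ (TY n) Z x _ ha hb]
      refine differentiableOn_matrix_inv (fun i j => ?_) (fun φ hφ => (isUnit_det_g3cLocBlock_of_coer Mc k (TY n) hγ Z (hco φ hφ) hx).ne_zero) ⟨a, ha⟩ ⟨b, hb⟩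
      simp only [g3cLocBlock, Matrix.add_apply, Matrix.smul_apply, Matrix.submatrix_apply, g3cLocOp, Matrix.of_apply, smul_eq_mul]
      refine (differentiableOn_const _).add (DifferentiableOn.fun_sum fun Y hY => ?_)
      rw [Finset.mem_filter] at hY
      exact fun φ hφ => ((han φ hφ Y hY.2 i.1.1 j.1.1).differentiableAt).differentiableWithinAt
    · simp only [g3cLocInv_apply_of_not_mem Mc k _ (TY n) Z x _ (Or.inr hb)]; exact differentiableOn_const _
  · simp only [g3cLocInv_apply_of_not_mem Mc k _ (TY n) Z x _ (Or.inl ha)]; exact differentiableOn_const _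

/-- **Entries of the admissible step matrices `S^M_{□,Y}(x, ·)` are holomorphic** on a set of pairs good for `X ⊇ Y ∪ □̃`. [cite: Balaban1987RG1, (1.18) p.263; Balaban1985BackgroundPropagators, (3.88) p.409] -/
theorem differentiableOn_g3cStepM_apply {c γ δ₁' : ℝ} (hγ : 0 < γ) (n : ℕ) {X : (recordDomSys F Mc k (recordK₀ F Mc k + n)).Dom}
    {O : Set (Sect2.CPair (F.P (recordK₀ F Mc k + n)) (MatA 2))}
    (hO : ∀ φ ∈ O, G3CPt F Mc k (recordK₀ F Mc k + n) (TY n) c γ δ₀ δ₁' X φ ∧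
      ∀ Y : (recordDomSys F Mc k (recordK₀ F Mc k + n)).Dom, Y.1 ⊆ X.1 →
        ∀ i j : FluctIdx F k (recordK₀ F Mc k + n), AnalyticAt ℂ (fun ψ : Sect2.CPair (F.P (recordK₀ F Mc k + n)) (MatA 2) => TY n Y ψ i j) φ)
    {x : ℝ} (hx : 0 ≤ x)
    (s : TPt (F.P (recordK₀ F Mc k + n)).d (Sect2.domCount (F.P (recordK₀ F Mc k + n)) Mc (k + 1)) × (recordDomSys F Mc k (recordK₀ F Mc k + n)).Dom)
    (hY : (s.2.1 : Finset _) ⊆ X.1) (hB : ((g3cBlk F Mc k (recordK₀ F Mc k + n) s.1).1 : Finset _) ⊆ X.1) (a b : NonB0Idx F k (recordK₀ F Mc k + n)) :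
    DifferentiableOn ℂ (fun φ => g3cStepM F Mc k (recordK₀ F Mc k + n) (TY n) x φ s a b) O := by
  by_cases hsub : (s.2.1 : Finset _) ⊆ (g3cBlk F Mc k (recordK₀ F Mc k + n) s.1).1
  · simp only [g3cStepM, if_pos hsub, Matrix.zero_apply]; exact differentiableOn_const _
  simp only [g3cStepM, if_neg hsub, g3cStep]
  refine differentiableOn_matrix_mul
    (M := fun φ => nonB0Block F k (recordK₀ F Mc k + n) (TY n s.2 φ) * g3cProj F Mc k (recordK₀ F Mc k + n) (g3cBlk F Mc k (recordK₀ F Mc k + n) s.1) * g3cLocInv F Mc k (recordK₀ F Mc k + n) (TY n) (g3cBlk F Mc k (recordK₀ F Mc k + n) s.1) x φ)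
    (N := fun _ => g3cInd F Mc k (recordK₀ F Mc k + n) s.1) (fun i j => ?_) (fun i j => differentiableOn_const _) a b
  refine differentiableOn_matrix_mul
    (M := fun φ => nonB0Block F k (recordK₀ F Mc k + n) (TY n s.2 φ) * g3cProj F Mc k (recordK₀ F Mc k + n) (g3cBlk F Mc k (recordK₀ F Mc k + n) s.1))
    (N := fun φ => g3cLocInv F Mc k (recordK₀ F Mc k + n) (TY n) (g3cBlk F Mc k (recordK₀ F Mc k + n) s.1) x φ) (fun i j => ?_) (fun i j => ?_) i j
  · refine differentiableOn_matrix_mul (M := fun φ => nonB0Block F k (recordK₀ F Mc k + n) (TY n s.2 φ)) (N := fun _ => g3cProj F Mc k (recordK₀ F Mc k + n) (g3cBlk F Mc k (recordK₀ F Mc k + n) s.1))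
      (fun i j => ?_) (fun i j => differentiableOn_const _) i j
    simp only [nonB0Block, Matrix.of_apply]
    exact fun φ hφ => (((hO φ hφ).2 s.2 hY i.1 j.1).differentiableAt).differentiableWithinAt
  · exact differentiableOn_g3cLocInv_apply hγ n _ (fun φ hφ Y hY' => (hO φ hφ).2 Y (hY'.trans hB)) (fun φ hφ => (hO φ hφ).1.2 _ hB) hx i j

/-- **The walk terms with localization `X` are holomorphic on a set of pairs good for `X`.** [cite: Balaban1987RG1, (1.18) p.263; Balaban1985BackgroundPropagators, (3.90) p.409] -/
theorem differentiableOn_g3cWalkTerm {c γ δ₁' : ℝ} (hγ : 0 < γ) (n : ℕ) {X : (recordDomSys F Mc k (recordK₀ F Mc k + n)).Dom}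
    {O : Set (Sect2.CPair (F.P (recordK₀ F Mc k + n)) (MatA 2))}
    (hO : ∀ φ ∈ O, G3CPt F Mc k (recordK₀ F Mc k + n) (TY n) c γ δ₀ δ₁' X φ ∧
      ∀ Y : (recordDomSys F Mc k (recordK₀ F Mc k + n)).Dom, Y.1 ⊆ X.1 →
        ∀ i j : FluctIdx F k (recordK₀ F Mc k + n), AnalyticAt ℂ (fun ψ : Sect2.CPair (F.P (recordK₀ F Mc k + n)) (MatA 2) => TY n Y ψ i j) φ)
    {x : ℝ} (hx : 0 ≤ x) (q₀ : TPt (F.P (recordK₀ F Mc k + n)).d (Sect2.domCount (F.P (recordK₀ F Mc k + n)) Mc (k + 1))) {m : ℕ}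
    (w : Fin m → TPt (F.P (recordK₀ F Mc k + n)).d (Sect2.domCount (F.P (recordK₀ F Mc k + n)) Mc (k + 1)) × (recordDomSys F Mc k (recordK₀ F Mc k + n)).Dom)
    (hloc : g3cWalkLoc F Mc k (recordK₀ F Mc k + n) q₀ w = X.1) :
    DifferentiableOn ℂ (fun φ => g3cWalkTerm F Mc k (recordK₀ F Mc k + n) (TY n) x φ q₀ w) O := by
  have hB0 : ((g3cBlk F Mc k (recordK₀ F Mc k + n) q₀).1 : Finset _) ⊆ X.1 := hloc ▸ blk_subset_g3cWalkLoc Mc k _ q₀ w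
  have hYi : ∀ i, ((w i).2.1 : Finset _) ⊆ X.1 := fun i => hloc ▸ dom_step_subset_g3cWalkLoc Mc k _ q₀ w i
  have hBi : ∀ i, ((g3cBlk F Mc k (recordK₀ F Mc k + n) (w i).1).1 : Finset _) ⊆ X.1 := fun i => hloc ▸ blk_step_subset_g3cWalkLoc Mc k _ q₀ w i
  have htr : (fun φ => g3cWalkTerm F Mc k (recordK₀ F Mc k + n) (TY n) x φ q₀ w) = fun φ => ∑ a : NonB0Idx F k (recordK₀ F Mc k + n),
      (g3cLocInv F Mc k (recordK₀ F Mc k + n) (TY n) (g3cBlk F Mc k (recordK₀ F Mc k + n) q₀) x φ * g3cInd F Mc k (recordK₀ F Mc k + n) q₀ *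
        (List.ofFn fun i => g3cStepM F Mc k (recordK₀ F Mc k + n) (TY n) x φ (w i)).prod) a a := rfl
  rw [htr]
  refine DifferentiableOn.fun_sum fun a _ => ?_
  refine differentiableOn_matrix_mul
    (M := fun φ => g3cLocInv F Mc k (recordK₀ F Mc k + n) (TY n) (g3cBlk F Mc k (recordK₀ F Mc k + n) q₀) x φ * g3cInd F Mc k (recordK₀ F Mc k + n) q₀)
    (N := fun φ => (List.ofFn fun i => g3cStepM F Mc k (recordK₀ F Mc k + n) (TY n) x φ (w i)).prod) (fun i j => ?_) (fun i j => ?_) a a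
  · refine differentiableOn_matrix_mul (M := fun φ => g3cLocInv F Mc k (recordK₀ F Mc k + n) (TY n) (g3cBlk F Mc k (recordK₀ F Mc k + n) q₀) x φ) (N := fun _ => g3cInd F Mc k (recordK₀ F Mc k + n) q₀)
      (fun i j => ?_) (fun i j => differentiableOn_const _) i j
    exact differentiableOn_g3cLocInv_apply hγ n _ (fun φ hφ Y hY' => (hO φ hφ).2 Y (hY'.trans hB0)) (fun φ hφ => (hO φ hφ).1.2 _ hB0) hx i j
  · exact differentiableOn_ofFn_prod_apply (fun i φ => g3cStepM F Mc k (recordK₀ F Mc k + n) (TY n) x φ (w i))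
      (fun i a b => differentiableOn_g3cStepM_apply hγ n hO hx (w i) (hYi i) (hBi i) a b) i j

/-- **`W_m(X)(x, ·)` is holomorphic on a set of pairs good for `X`.** [cite: Balaban1987RG1, (1.18) p.263] -/
theorem differentiableOn_g3cWm {c γ δ₁' : ℝ} (hγ : 0 < γ) (n : ℕ) {X : (recordDomSys F Mc k (recordK₀ F Mc k + n)).Dom}
    {O : Set (Sect2.CPair (F.P (recordK₀ F Mc k + n)) (MatA 2))}
    (hO : ∀ φ ∈ O, G3CPt F Mc k (recordK₀ F Mc k + n) (TY n) c γ δ₀ δ₁' X φ ∧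
      ∀ Y : (recordDomSys F Mc k (recordK₀ F Mc k + n)).Dom, Y.1 ⊆ X.1 →
        ∀ i j : FluctIdx F k (recordK₀ F Mc k + n), AnalyticAt ℂ (fun ψ : Sect2.CPair (F.P (recordK₀ F Mc k + n)) (MatA 2) => TY n Y ψ i j) φ)
    {x : ℝ} (hx : 0 ≤ x) (m : ℕ) :
    DifferentiableOn ℂ (fun φ => g3cWm F Mc k (recordK₀ F Mc k + n) (TY n) x φ m X) O := by
  simp only [g3cWm]
  refine DifferentiableOn.fun_sum fun q₀ _ => DifferentiableOn.fun_sum fun w _ => ?_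
  by_cases hloc : g3cWalkLoc F Mc k (recordK₀ F Mc k + n) q₀ w = X.1
  · simp only [if_pos hloc]; exact differentiableOn_g3cWalkTerm hγ n hO hx q₀ w hloc
  · simp only [if_neg hloc]; exact differentiableOn_const _

/-! ## §2  Continuity in `x ∈ [0, ∞)` at one pair of `G3CPt … X φ` -/

/-- **Entries of `S^M_{□,Y}(·, φ)` are continuous on `[0, ∞)`** at a pair where `T^{(□̃)}|_□̃` is coercive. [cite: Balaban1985UV3, p.272 (after (63))] -/
theorem continuousOn_g3cStepM_apply {c γ δ₁' : ℝ} (hγ : 0 < γ) (n : ℕ) {X : (recordDomSys F Mc k (recordK₀ F Mc k + n)).Dom}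
    {φ : Sect2.CPair (F.P (recordK₀ F Mc k + n)) (MatA 2)} (hpt : G3CPt F Mc k (recordK₀ F Mc k + n) (TY n) c γ δ₀ δ₁' X φ)
    (s : TPt (F.P (recordK₀ F Mc k + n)).d (Sect2.domCount (F.P (recordK₀ F Mc k + n)) Mc (k + 1)) × (recordDomSys F Mc k (recordK₀ F Mc k + n)).Dom)
    (hB : ((g3cBlk F Mc k (recordK₀ F Mc k + n) s.1).1 : Finset _) ⊆ X.1) (a b : NonB0Idx F k (recordK₀ F Mc k + n)) :
    ContinuousOn (fun x : ℝ => g3cStepM F Mc k (recordK₀ F Mc k + n) (TY n) x φ s a b) (Set.Ici 0) := by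
  by_cases hsub : (s.2.1 : Finset _) ⊆ (g3cBlk F Mc k (recordK₀ F Mc k + n) s.1).1
  · simp only [g3cStepM, if_pos hsub, Matrix.zero_apply]; exact continuousOn_const
  simp only [g3cStepM, if_neg hsub, g3cStep]
  refine continuousOn_matrix_mul
    (M := fun x : ℝ => nonB0Block F k (recordK₀ F Mc k + n) (TY n s.2 φ) * g3cProj F Mc k (recordK₀ F Mc k + n) (g3cBlk F Mc k (recordK₀ F Mc k + n) s.1) * g3cLocInv F Mc k (recordK₀ F Mc k + n) (TY n) (g3cBlk F Mc k (recordK₀ F Mc k + n) s.1) x φ)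
    (N := fun _ => g3cInd F Mc k (recordK₀ F Mc k + n) s.1) (fun i j => ?_) (fun i j => continuousOn_const) a b
  refine continuousOn_matrix_mul
    (M := fun _ : ℝ => nonB0Block F k (recordK₀ F Mc k + n) (TY n s.2 φ) * g3cProj F Mc k (recordK₀ F Mc k + n) (g3cBlk F Mc k (recordK₀ F Mc k + n) s.1))
    (N := fun x : ℝ => g3cLocInv F Mc k (recordK₀ F Mc k + n) (TY n) (g3cBlk F Mc k (recordK₀ F Mc k + n) s.1) x φ) (fun i j => continuousOn_const) (fun i j => ?_) i j
  exact continuousOn_g3cLocInv_apply_of_coer Mc k (TY n) hγ _ (hpt.2 _ hB) i j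

/-- **The walk terms with localization `X` are continuous in `x ∈ [0, ∞)`** at a pair of `G3CPt … X φ`. [cite: Balaban1985UV3, p.272 (after (63))] -/
theorem continuousOn_g3cWalkTerm {c γ δ₁' : ℝ} (hγ : 0 < γ) (n : ℕ) {X : (recordDomSys F Mc k (recordK₀ F Mc k + n)).Dom}
    {φ : Sect2.CPair (F.P (recordK₀ F Mc k + n)) (MatA 2)} (hpt : G3CPt F Mc k (recordK₀ F Mc k + n) (TY n) c γ δ₀ δ₁' X φ)
    (q₀ : TPt (F.P (recordK₀ F Mc k + n)).d (Sect2.domCount (F.P (recordK₀ F Mc k + n)) Mc (k + 1))) {m : ℕ}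
    (w : Fin m → TPt (F.P (recordK₀ F Mc k + n)).d (Sect2.domCount (F.P (recordK₀ F Mc k + n)) Mc (k + 1)) × (recordDomSys F Mc k (recordK₀ F Mc k + n)).Dom)
    (hloc : g3cWalkLoc F Mc k (recordK₀ F Mc k + n) q₀ w = X.1) :
    ContinuousOn (fun x : ℝ => g3cWalkTerm F Mc k (recordK₀ F Mc k + n) (TY n) x φ q₀ w) (Set.Ici 0) := by
  have hB0 : ((g3cBlk F Mc k (recordK₀ F Mc k + n) q₀).1 : Finset _) ⊆ X.1 := hloc ▸ blk_subset_g3cWalkLoc Mc k _ q₀ w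
  have hBi : ∀ i, ((g3cBlk F Mc k (recordK₀ F Mc k + n) (w i).1).1 : Finset _) ⊆ X.1 := fun i => hloc ▸ blk_step_subset_g3cWalkLoc Mc k _ q₀ w i
  have htr : (fun x : ℝ => g3cWalkTerm F Mc k (recordK₀ F Mc k + n) (TY n) x φ q₀ w) = fun x => ∑ a : NonB0Idx F k (recordK₀ F Mc k + n),
      (g3cLocInv F Mc k (recordK₀ F Mc k + n) (TY n) (g3cBlk F Mc k (recordK₀ F Mc k + n) q₀) x φ * g3cInd F Mc k (recordK₀ F Mc k + n) q₀ *
        (List.ofFn fun i => g3cStepM F Mc k (recordK₀ F Mc k + n) (TY n) x φ (w i)).prod) a a := rfl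
  rw [htr]
  refine continuousOn_finsetSum _ fun a _ => ?_
  refine continuousOn_matrix_mul
    (M := fun x : ℝ => g3cLocInv F Mc k (recordK₀ F Mc k + n) (TY n) (g3cBlk F Mc k (recordK₀ F Mc k + n) q₀) x φ * g3cInd F Mc k (recordK₀ F Mc k + n) q₀)
    (N := fun x : ℝ => (List.ofFn fun i => g3cStepM F Mc k (recordK₀ F Mc k + n) (TY n) x φ (w i)).prod) (fun i j => ?_) (fun i j => ?_) a a
  · refine continuousOn_matrix_mul (M := fun x : ℝ => g3cLocInv F Mc k (recordK₀ F Mc k + n) (TY n) (g3cBlk F Mc k (recordK₀ F Mc k + n) q₀) x φ) (N := fun _ => g3cInd F Mc k (recordK₀ F Mc k + n) q₀)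
      (fun i j => ?_) (fun i j => continuousOn_const) i j
    exact continuousOn_g3cLocInv_apply_of_coer Mc k (TY n) hγ _ (hpt.2 _ hB0) i j
  · exact continuousOn_ofFn_prod_apply (fun i x => g3cStepM F Mc k (recordK₀ F Mc k + n) (TY n) x φ (w i))
      (fun i a b => continuousOn_g3cStepM_apply hγ n hpt (w i) (hBi i) a b) i j

/-- **`W_m(X)(·, φ)` is continuous on `[0, ∞)`** at a pair of `G3CPt … X φ`. [cite: Balaban1985UV3, p.272 (after (63))] -/
theorem continuousOn_g3cWm {c γ δ₁' : ℝ} (hγ : 0 < γ) (n : ℕ) {X : (recordDomSys F Mc k (recordK₀ F Mc k + n)).Dom}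
    {φ : Sect2.CPair (F.P (recordK₀ F Mc k + n)) (MatA 2)} (hpt : G3CPt F Mc k (recordK₀ F Mc k + n) (TY n) c γ δ₀ δ₁' X φ) (m : ℕ) :
    ContinuousOn (fun x : ℝ => g3cWm F Mc k (recordK₀ F Mc k + n) (TY n) x φ m X) (Set.Ici 0) := by
  simp only [g3cWm]
  refine continuousOn_finsetSum _ fun q₀ _ => continuousOn_finsetSum _ fun w _ => ?_
  by_cases hloc : g3cWalkLoc F Mc k (recordK₀ F Mc k + n) q₀ w = X.1
  · simp only [if_pos hloc]; exact continuousOn_g3cWalkTerm hγ n hpt q₀ w hloc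
  · simp only [if_neg hloc]; exact continuousOn_const

/-! ## §3  The series: bound, holomorphy, continuity -/

/-- ★ **THE x-UNIFORM BOUND `|W(X)(x, φ)| ≤ 2·B₀(X)`**, `B₀(X) = (N_□/γ)·e^{κt·81}·#X·e^{−κt·d_j(X)}`, at a pair of `G3CPt … X φ` with `Λ ≤ ½`, `x ≥ 0` — row (g3) for the walk piece.
[cite: Balaban1987RG1, (1.18) p.263; Balaban1985UV3, (25) p.262] -/
theorem norm_g3cW_le (hP : P0CarrierClauses F a₀ δ₀ c₀ γ₀ γ₁ Mc α₀ α₁ ε₂₉ k TC TY TZY AdM AdZ) (hMc : McGuard F Mc) {c γ δ₁' κ' κt : ℝ} (hc : 0 ≤ c)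
    (hγ : 0 < γ) (hδ₁ : 0 < δ₁') (hκ : 0 ≤ κ') (hκδ : 2 * κ' ≤ δ₁') (hκc : 4 * κ' * (c * K₀ (4 * 2 ^ 4) (2 * 4)) ≤ γ * δ₁')
    (hκt : 0 ≤ κt) (hδ₀ : kappa₀ (4 * 2 ^ 4) (2 * 4) + κt + 1 ≤ δ₀) (hΛ : g3cLam F Mc c γ δ₀ κ' κt ≤ 1 / 2)
    (n : ℕ) {X : (recordDomSys F Mc k (recordK₀ F Mc k + n)).Dom} {φ : Sect2.CPair (F.P (recordK₀ F Mc k + n)) (MatA 2)}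
    (hpt : G3CPt F Mc k (recordK₀ F Mc k + n) (TY n) c γ δ₀ δ₁' X φ) {x : ℝ} (hx : 0 ≤ x) :
    ‖g3cW F Mc k (recordK₀ F Mc k + n) (TY n) x φ X‖ ≤
      2 * ((3 * (F.P (recordK₀ F Mc k + n)).d * (F.L * Mc) ^ (F.P (recordK₀ F Mc k + n)).d : ℕ) * (1 / γ) *
        Real.exp (κt * ((3 ^ (F.P (recordK₀ F Mc k + n)).d * 3 ^ (F.P (recordK₀ F Mc k + n)).d : ℕ) : ℝ)) *
        ((X.1 : Finset _).card : ℝ) * Real.exp (-(κt * (recordDomSys F Mc k (recordK₀ F Mc k + n)).dj X))) := by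
  have hδ₀' : kappa₀ (4 * 2 ^ 4) (2 * 4) ≤ δ₀ := by linarith
  set B : ℝ := (3 * (F.P (recordK₀ F Mc k + n)).d * (F.L * Mc) ^ (F.P (recordK₀ F Mc k + n)).d : ℕ) * (1 / γ) *
        Real.exp (κt * ((3 ^ (F.P (recordK₀ F Mc k + n)).d * 3 ^ (F.P (recordK₀ F Mc k + n)).d : ℕ) : ℝ)) *
        ((X.1 : Finset _).card : ℝ) * Real.exp (-(κt * (recordDomSys F Mc k (recordK₀ F Mc k + n)).dj X)) with hB
  have hB0 : 0 ≤ B := by positivity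
  have hΛ0 : 0 ≤ g3cLam F Mc c γ δ₀ κ' κt := by
    unfold g3cLam; have := K₀_pos (4 * 2 ^ 4 : ℝ) (2 * 4); positivity
  have hgeo : HasSum (fun m : ℕ => B * ((1 : ℝ) / 2) ^ m) (B * 2) := hasSum_geometric_two.mul_left B
  rw [g3cW, show 2 * B = B * 2 by ring]
  refine tsum_of_norm_bounded hgeo fun m => ?_
  rw [norm_mul, norm_pow, norm_neg, norm_one, one_pow, one_mul]
  refine (norm_g3cWm_le hP hMc hc hγ hδ₁ hδ₀' hκ hκδ hκc hκt n hpt hx m (sum_g3cStepWt_le Mc k _ κ' hc hγ hκt hδ₀)).trans ?_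
  rw [← hB]
  exact mul_le_mul_of_nonneg_left (pow_le_pow_left₀ hΛ0 hΛ m) hB0

/-- ★ **HOLOMORPHY OF `W(X)(x, ·)` ON AN OPEN SET OF GOOD PAIRS** (row (g2) for the walk piece): the SCV M-test with the x-uniform majorant. [cite: Balaban1987RG1, (1.18) p.263; Balaban1985UV3, p.272] -/
theorem differentiableOn_g3cW (hP : P0CarrierClauses F a₀ δ₀ c₀ γ₀ γ₁ Mc α₀ α₁ ε₂₉ k TC TY TZY AdM AdZ) (hMc : McGuard F Mc) {c γ δ₁' κ' κt : ℝ} (hc : 0 ≤ c)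
    (hγ : 0 < γ) (hδ₁ : 0 < δ₁') (hκ : 0 ≤ κ') (hκδ : 2 * κ' ≤ δ₁') (hκc : 4 * κ' * (c * K₀ (4 * 2 ^ 4) (2 * 4)) ≤ γ * δ₁')
    (hκt : 0 ≤ κt) (hδ₀ : kappa₀ (4 * 2 ^ 4) (2 * 4) + κt + 1 ≤ δ₀) (hΛ : g3cLam F Mc c γ δ₀ κ' κt ≤ 1 / 2)
    (n : ℕ) {X : (recordDomSys F Mc k (recordK₀ F Mc k + n)).Dom} {O : Set (Sect2.CPair (F.P (recordK₀ F Mc k + n)) (MatA 2))} (hOo : IsOpen O)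
    (hO : ∀ φ ∈ O, G3CPt F Mc k (recordK₀ F Mc k + n) (TY n) c γ δ₀ δ₁' X φ ∧
      ∀ Y : (recordDomSys F Mc k (recordK₀ F Mc k + n)).Dom, Y.1 ⊆ X.1 →
        ∀ i j : FluctIdx F k (recordK₀ F Mc k + n), AnalyticAt ℂ (fun ψ : Sect2.CPair (F.P (recordK₀ F Mc k + n)) (MatA 2) => TY n Y ψ i j) φ)
    {x : ℝ} (hx : 0 ≤ x) :
    DifferentiableOn ℂ (fun φ => g3cW F Mc k (recordK₀ F Mc k + n) (TY n) x φ X) O := by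
  have hδ₀' : kappa₀ (4 * 2 ^ 4) (2 * 4) ≤ δ₀ := by linarith
  set B : ℝ := (3 * (F.P (recordK₀ F Mc k + n)).d * (F.L * Mc) ^ (F.P (recordK₀ F Mc k + n)).d : ℕ) * (1 / γ) *
        Real.exp (κt * ((3 ^ (F.P (recordK₀ F Mc k + n)).d * 3 ^ (F.P (recordK₀ F Mc k + n)).d : ℕ) : ℝ)) *
        ((X.1 : Finset _).card : ℝ) * Real.exp (-(κt * (recordDomSys F Mc k (recordK₀ F Mc k + n)).dj X)) with hB
  have hB0 : 0 ≤ B := by positivity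
  have hΛ0 : 0 ≤ g3cLam F Mc c γ δ₀ κ' κt := by
    unfold g3cLam; have := K₀_pos (4 * 2 ^ 4 : ℝ) (2 * 4); positivity
  have hsum : Summable (fun m : ℕ => B * ((1 : ℝ) / 2) ^ m) := (hasSum_geometric_two.mul_left B).summable
  have han := Literature.Analysis.Complex.SCV.analyticOnNhd_tsum_of_summable_norm (F := ℂ) hOo
    (f := fun (m : ℕ) (φ : Sect2.CPair (F.P (recordK₀ F Mc k + n)) (MatA 2)) => (-1 : ℂ) ^ m * g3cWm F Mc k (recordK₀ F Mc k + n) (TY n) x φ m X)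
    (fun m => (differentiableOn_const _).mul (differentiableOn_g3cWm hγ n hO hx m)) hsum (fun m φ hφ => by
      rw [norm_mul, norm_pow, norm_neg, norm_one, one_pow, one_mul]
      refine (norm_g3cWm_le hP hMc hc hγ hδ₁ hδ₀' hκ hκδ hκc hκt n (hO φ hφ).1 hx m (sum_g3cStepWt_le Mc k _ κ' hc hγ hκt hδ₀)).trans ?_
      rw [← hB]
      exact mul_le_mul_of_nonneg_left (pow_le_pow_left₀ hΛ0 hΛ m) hB0)
  exact han.differentiableOn

/-- ★ **CONTINUITY OF `W(X)(·, φ)` ON `[0, ∞)`** at a pair of `G3CPt … X φ` with `Λ ≤ ½` (row (g5) for the walk piece): `continuousOn_tsum` with the x-uniform majorant.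
[cite: Balaban1985UV3, p.272 (after (63)); Balaban1987RG1, (1.18) p.263] -/
theorem continuousOn_g3cW (hP : P0CarrierClauses F a₀ δ₀ c₀ γ₀ γ₁ Mc α₀ α₁ ε₂₉ k TC TY TZY AdM AdZ) (hMc : McGuard F Mc) {c γ δ₁' κ' κt : ℝ} (hc : 0 ≤ c)
    (hγ : 0 < γ) (hδ₁ : 0 < δ₁') (hκ : 0 ≤ κ') (hκδ : 2 * κ' ≤ δ₁') (hκc : 4 * κ' * (c * K₀ (4 * 2 ^ 4) (2 * 4)) ≤ γ * δ₁')
    (hκt : 0 ≤ κt) (hδ₀ : kappa₀ (4 * 2 ^ 4) (2 * 4) + κt + 1 ≤ δ₀) (hΛ : g3cLam F Mc c γ δ₀ κ' κt ≤ 1 / 2)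
    (n : ℕ) {X : (recordDomSys F Mc k (recordK₀ F Mc k + n)).Dom} {φ : Sect2.CPair (F.P (recordK₀ F Mc k + n)) (MatA 2)}
    (hpt : G3CPt F Mc k (recordK₀ F Mc k + n) (TY n) c γ δ₀ δ₁' X φ) :
    ContinuousOn (fun x : ℝ => g3cW F Mc k (recordK₀ F Mc k + n) (TY n) x φ X) (Set.Ici 0) := by
  have hδ₀' : kappa₀ (4 * 2 ^ 4) (2 * 4) ≤ δ₀ := by linarith
  set B : ℝ := (3 * (F.P (recordK₀ F Mc k + n)).d * (F.L * Mc) ^ (F.P (recordK₀ F Mc k + n)).d : ℕ) * (1 / γ) *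
        Real.exp (κt * ((3 ^ (F.P (recordK₀ F Mc k + n)).d * 3 ^ (F.P (recordK₀ F Mc k + n)).d : ℕ) : ℝ)) *
        ((X.1 : Finset _).card : ℝ) * Real.exp (-(κt * (recordDomSys F Mc k (recordK₀ F Mc k + n)).dj X)) with hB
  have hB0 : 0 ≤ B := by positivity
  have hΛ0 : 0 ≤ g3cLam F Mc c γ δ₀ κ' κt := by
    unfold g3cLam; have := K₀_pos (4 * 2 ^ 4 : ℝ) (2 * 4); positivity
  have hsum : Summable (fun m : ℕ => B * ((1 : ℝ) / 2) ^ m) := (hasSum_geometric_two.mul_left B).summable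
  simp only [g3cW]
  refine continuousOn_tsum (fun m => continuousOn_const.mul (continuousOn_g3cWm hγ n hpt m)) hsum fun m x hx => ?_
  rw [norm_mul, norm_pow, norm_neg, norm_one, one_pow, one_mul]
  refine (norm_g3cWm_le hP hMc hc hγ hδ₁ hδ₀' hκ hκδ hκc hκt n hpt (Set.mem_Ici.1 hx) m (sum_g3cStepWt_le Mc k _ κ' hc hγ hκt hδ₀)).trans ?_
  rw [← hB]
  exact mul_le_mul_of_nonneg_left (pow_le_pow_left₀ hΛ0 hΛ m) hB0

end Holo

end Summit.QuantumFields.YangMills.Theorems.BalabanUVNodesPortS1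

end
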